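import Summits.CriticalPhenomena.PercolationContinuityZ3.Theorems.SahiMasterFamilyPointwiseCoordinateGluingSandwichApex
import Summits.CriticalPhenomena.PercolationContinuityZ3.Theorems.PercNearOneGluingNoHeavyLowerTailSahiCoordinateCanalyzingPeel

/-!
# One-face domination at order 3, `1`-minor side — the family form (`Z_3` hypothesis on the `1`-minor, any slot order, empty members allowed)

Unit `prim-master-conj` (crux anchor stmt-CriticalPhenomena-4575, helper work), gen 18; memo
`run/shared/lean/prim/prim-l12/prim-master-conj/POINTWISE.md` §19.  Repackaging of `Pointwise.sahiE_three_ge_sq_of_zVia`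
(`…CoordinateGluingSandwichApex`) for a `Fin 3`-family: **if `U` is an increasing triple and its `1`-minor `(U_j^{e←1})_j` lies in `Z_3`
(`SuppZeroFlag 3`, in ANY slot order, empty members allowed) then `(1 − p_e)²·E_3(μ_p; U^{e←0}) ≤ E_3(μ_p; U)` for every `p`**
(`sahiE_three_ge_sq_of_suppZeroFlag_secAt_true`), and `C_3` is inherited from the `0`-minor (`sahiE_three_nonneg_of_suppZeroFlag_secAt_true`).
Plumbing: `Z_3` of a triple is `ZVia` at some slot (`suppZeroFlag_three_iff_exists`), `E_3` is symmetric (`sahiE_three_reindex`), `E_3(f,g,h) = E_3(g,h,f)` is P-seat's `SahiCoordinateGluing.sahiE_three_rotate`, and a member with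
empty `1`-section is empty (`eq_empty_of_secAt_true_eq_empty`), in which case both sides vanish.  Axioms standard. [this work]
-/

noncomputable section

open scoped Classical

namespace Summit.CriticalPhenomena.PercolationContinuityZ3.Theorems

open Finset Function
open Literature.Combinatorics.Sahi2008
open Literature.Probability.Percolation.DecisionTree (ind)

namespace Pointwise

variable {ι : Type} [Fintype ι]

/-- **Reindexing `E_3` so that a chosen slot `i` comes last**: `E_3(F) = E_3(F (i.succAbove 0), F (i.succAbove 1), F i)`. [folklore] -/
theorem sahiE_three_reindex (μ : Set ι → ℝ) (F : Fin 3 → Set ι → ℝ) (i : Fin 3) :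
    sahiE μ 3 F = sahiE μ 3 ![F (i.succAbove 0), F (i.succAbove 1), F i] := by
  rw [sahiE_eq_cons_succAbove μ 1 F i]
  have hc : (Fin.cons (F i) (fun j => F (i.succAbove j)) : Fin 3 → Set ι → ℝ) = ![F i, F (i.succAbove 0), F (i.succAbove 1)] := by
    funext j
    refine Fin.cases ?_ (fun k => ?_) j
    · rfl
    · rw [Fin.cons_succ]
      rcases Fin.exists_fin_two.1 ⟨k, rfl⟩ with hk | hk <;> rw [hk] <;> rfl
  rw [hc, SahiCoordinateGluing.sahiE_three_rotate]

omit [Fintype ι] in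
/-- An increasing event whose `1`-section at `e` is empty is empty. [folklore] -/
theorem eq_empty_of_secAt_true_eq_empty (e : ι) {A : Set (Set ι)} (hA : IsUpperSet A) (h : secAt e true A = ∅) : A = ∅ := by
  by_contra hne
  obtain ⟨ω, hω⟩ := Set.nonempty_iff_ne_empty.2 hne
  have : ω ∈ secAt e true A := by
    rw [mem_secAt]
    exact hA (Set.subset_insert e ω) hω
  rw [h] at this
  exact this

/-- **One-face domination at order 3, `1`-minor side, family form**: for an increasing triple `U` whose `1`-minor along `e` is in `Z_3`
(any slot order; empty members allowed), `(1 − p_e)²·E_3(μ_p; U^{e←0}) ≤ E_3(μ_p; U)`. [this work] -/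
theorem sahiE_three_ge_sq_of_suppZeroFlag_secAt_true (p : ι → unitInterval) (e : ι) (U : Fin 3 → Set (Set ι))
    (hU : ∀ j, IsUpperSet (U j)) (hZ : SuppZeroFlag 3 (fun j => secAt e true (U j))) :
    (1 - (p e : ℝ)) ^ 2 * sahiE (bernoulliWeight p) 3 (fun j => ind (secAt e false (U j)))
      ≤ sahiE (bernoulliWeight p) 3 (fun j => ind (U j)) := by
  obtain ⟨i, h1, h2, h3⟩ := (suppZeroFlag_three_iff_exists _).1 hZ
  set A := U (i.succAbove 0) with hAdef
  set B := U (i.succAbove 1) with hBdef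
  set D := U i with hDdef
  have hZV : ZVia (secAt e true A) (secAt e true B) (secAt e true D) := ⟨h1, h2, h3⟩
  -- reindex both sides so that the apex slot `i` is last
  rw [sahiE_three_reindex _ (fun j => ind (U j)) i, sahiE_three_reindex _ (fun j => ind (secAt e false (U j))) i]
  change (1 - (p e : ℝ)) ^ 2 * sahiE (bernoulliWeight p) 3 ![ind (secAt e false A), ind (secAt e false B), ind (secAt e false D)]
      ≤ sahiE (bernoulliWeight p) 3 ![ind A, ind B, ind D]
  by_cases hAe : secAt e true A = ∅
  · -- `A = ∅`: both sides vanish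
    have hA0 : A = ∅ := eq_empty_of_secAt_true_eq_empty e (hU _) hAe
    have r1 : sahiE (bernoulliWeight p) 3 ![ind A, ind B, ind D] = 0 := by
      have := masterFamilyEqIff_mpr 3 ι p ![A, B, D] (suppZeroFlag_of_mem_empty 2 _ 0 (by simp [hA0]))
      have hv : (fun j => ind ((![A, B, D] : Fin 3 → Set (Set ι)) j)) = ![ind A, ind B, ind D] := by funext j; fin_cases j <;> rfl
      rwa [hv] at this
    have r0 : sahiE (bernoulliWeight p) 3 ![ind (secAt e false A), ind (secAt e false B), ind (secAt e false D)] = 0 := by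
      have hem : secAt e false A = ∅ := by rw [hA0]; ext ω; simp [mem_secAt]
      have := masterFamilyEqIff_mpr 3 ι p ![secAt e false A, secAt e false B, secAt e false D]
        (suppZeroFlag_of_mem_empty 2 _ 0 (by simp [hem]))
      have hv : (fun j => ind ((![secAt e false A, secAt e false B, secAt e false D] : Fin 3 → Set (Set ι)) j)) =
          ![ind (secAt e false A), ind (secAt e false B), ind (secAt e false D)] := by funext j; fin_cases j <;> rfl
      rwa [hv] at this
    rw [r0, r1, mul_zero]
  by_cases hBe : secAt e true B = ∅
  · have hB0 : B = ∅ := eq_empty_of_secAt_true_eq_empty e (hU _) hBe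
    have r1 : sahiE (bernoulliWeight p) 3 ![ind A, ind B, ind D] = 0 := by
      have := masterFamilyEqIff_mpr 3 ι p ![A, B, D] (suppZeroFlag_of_mem_empty 2 _ 1 (by simp [hB0]))
      have hv : (fun j => ind ((![A, B, D] : Fin 3 → Set (Set ι)) j)) = ![ind A, ind B, ind D] := by funext j; fin_cases j <;> rfl
      rwa [hv] at this
    have r0 : sahiE (bernoulliWeight p) 3 ![ind (secAt e false A), ind (secAt e false B), ind (secAt e false D)] = 0 := by
      have hem : secAt e false B = ∅ := by rw [hB0]; ext ω; simp [mem_secAt]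
      have := masterFamilyEqIff_mpr 3 ι p ![secAt e false A, secAt e false B, secAt e false D]
        (suppZeroFlag_of_mem_empty 2 _ 1 (by simp [hem]))
      have hv : (fun j => ind ((![secAt e false A, secAt e false B, secAt e false D] : Fin 3 → Set (Set ι)) j)) =
          ![ind (secAt e false A), ind (secAt e false B), ind (secAt e false D)] := by funext j; fin_cases j <;> rfl
      rwa [hv] at this
    rw [r0, r1, mul_zero]
  exact sahiE_three_ge_sq_of_zVia p e A B D (hU _) (hU _) (hU _) (Set.nonempty_iff_ne_empty.2 hAe) (Set.nonempty_iff_ne_empty.2 hBe) hZV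

/-- **`C_3` inherited from the `0`-minor when the `1`-minor is in `Z_3`** (family form): `E_3(μ_p; U^{e←0}) ≥ 0 ⟹ E_3(μ_p; U) ≥ 0`. [this work] -/
theorem sahiE_three_nonneg_of_suppZeroFlag_secAt_true (p : ι → unitInterval) (e : ι) (U : Fin 3 → Set (Set ι))
    (hU : ∀ j, IsUpperSet (U j)) (hZ : SuppZeroFlag 3 (fun j => secAt e true (U j)))
    (h0 : 0 ≤ sahiE (bernoulliWeight p) 3 (fun j => ind (secAt e false (U j)))) :
    0 ≤ sahiE (bernoulliWeight p) 3 (fun j => ind (U j)) :=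
  le_trans (mul_nonneg (pow_nonneg (sub_nonneg.2 (p e).2.2) 2) h0) (sahiE_three_ge_sq_of_suppZeroFlag_secAt_true p e U hU hZ)

end Pointwise

end Summit.CriticalPhenomena.PercolationContinuityZ3.Theorems

end
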